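import Summits.BirchSwinnertonDyer.BirchSwinnertonDyer.Theorems.ThetaPartnerAtTwoSignedMainConjectureCMTwoRankZeroPTDeepClose
import Summits.BirchSwinnertonDyer.BirchSwinnertonDyer.Theorems.ThetaPartnerAtTwoSignedMainConjectureCMTwoRankZeroPTDeepIntegralBad
import HarnessLib

/-!
# Route `ThetaPartnerAtTwo` (TP2), crux K2R0P♭ `SignedMainConjectureCMTwoRankZeroOfPubOfFlat` (stmt-BirchSwinnertonDyer-26471;
# derived node K2r0P stmt-BirchSwinnertonDyer-24945), line `rankzero` v20 — the registered stub `stub_poitouTateDeepTwo` ((S_PT), habitat form)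
# CLOSED MODULO ONE INPUT: (E), the levelwise Poitou–Tate existence in the admissible sets.  The second input (I)_bad of
# `poitouTateDeepTwo_of_levelwise_of_badInertia` (`…PTDeepClose`) is DISCHARGED by the width seat w5's theorem
# `SignedLowerOffTwo.PTDeep.exists_pow_smul_resLe_inertia_tate_eq_zero_of_hasCM` (`…PTDeepIntegralBad`, brick B6c: CM ⇒ every bad place additive
# potentially good ⇒ one `2`-power kills every class of `H¹(Γ_n, T₂A)` on `Γ_n ⊓ I_𝔓`, `𝔓` over a bad odd place, uniformly in `n`)

HONEST FRAMING (cell `pub/bsd-wall`, W-ALL row 1; lead prover `bsd-wall-tp2-p2` g10, `--supports` only). THEOREMS ONLY; CONDITIONAL on the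
displayed hypothesis `hE` ((E) = bricks B1/B3/B4/B5 of the kernel route, seats w2/w3/w4), whose TYPE is pinned here byte-for-byte; closes no item;
BSD is NOT proved by any of this.

References: [Kobayashi2003] (7.17)–(7.20), Thm. 7.3 (ii); [MilneADT2006] I Thm. 4.10; [Rubin2000] App. B Prop. B.2.3, §B.3; [SilvermanAEC2009] X.4.3,
VII.5; [SerreTate1968] §2 (potential good reduction ⇒ finite inertia image).
-/

set_option autoImplicit false
-- the Theorems namespace of this sub repeats the summit name by design (D-0017 nested layout)
set_option linter.dupNamespace false

noncomputable section

open scoped Classical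

namespace Summit.BirchSwinnertonDyer.BirchSwinnertonDyer.Theorems

namespace SignedLowerOffTwo.PTDeep

open CategoryTheory NumberField IsDedekindDomain Field WeierstrassCurve
  Literature.NumberTheory.EllipticCurves Literature.NumberTheory.EllipticCurves.Kobayashi2003
  Literature.NumberTheory.EllipticCurves.Sprung2012 Literature.NumberTheory.GaloisRepresentations
  Literature.NumberTheory.EllipticCurves.Rank1Residual
  Literature.NumberTheory.EllipticCurves.Kato2004 Literature.NumberTheory.EllipticCurves.Kato2004.EulerSystemValues ZpExtension
  Rat.HeightOneSpectrum Summit.BirchSwinnertonDyer.Rank1Residual.Supersingular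

/-- **`stub_poitouTateDeepTwo` ((S_PT), habitat form) modulo (E) alone.**  `hE` = for every `v ∋ 2`, CM class member `A`, cyclotomic `κ`, `γ`,
THE pairing ((P3)): `∃ m₀, ∀ z` with H(z), `∀ n k, ∃ c ∈ H¹(Γ_n, A[2^k])` unramified outside `S_A = {w ∋ 2} ∪ A.badPlaces` with
`⟨c, Q⟩_{n,2^k} = 2^{m₀} z(Q) mod 2^k` on `E⁺(ℚ_n·ℚ_v)` (Milne I 4.10 (b) levelwise, bricks B1/B3/B4/B5); (I)_bad is w5's B6c.
[cite: Kobayashi2003, (7.17)–(7.20) and Thm. 7.3 (ii) (pp. 12–13)] [cite: MilneADT2006, Ch. I Thm. 4.10] [cite: Rubin2000, App. B Prop. B.2.3 and §B.3]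
[cite: SerreTate1968, §2 Thm. 2] -/
theorem poitouTateDeepTwo_of_levelwise_exists
    (hE : ∀ (v : HeightOneSpectrum (𝓞 ℚ)), ((2 : ℕ) : 𝓞 ℚ) ∈ v.asIdeal →
      ∀ (A : WeierstrassCurve ℚ) [A.IsElliptic] [A.IsGloballyMinimal],
        A.HasCM → A.analyticRank = 0 → GoodSS A 2 → A.frobeniusTrace 2 = 0 →
        ∀ (κ : ZpExtension ℚ 2) (γ : Field.absoluteGaloisGroup ℚ),
          κ.IsCyclotomic → κ.IsTopGenerator γ →
        ∀ [ContinuousSMul ℤ_[2] (A.tateModule 2)]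
          (pair : ∀ n : ℕ, H1 (tateRep A 2) (κ.layerSubgroup n) →ₗ[ℤ_[2]]
            (localLayerPointsOfEmb κ (closureEmb (K := ℚ) (v.adicCompletion ℚ)) A n →+ ℤ_[2])),
          (∀ (n k : ℕ) (x : H1 (tateRep A 2) (κ.layerSubgroup n))
            (Q : localLayerPointsOfEmb κ (closureEmb (K := ℚ) (v.adicCompletion ℚ)) A n),
            PadicInt.toZModPow k (pair n x Q) = CyclotomicLayer.tatePairingPk A κ v n k x Q) →
        ∃ m₀ : ℕ,
          ∀ z : localTowerPointsOfEmb κ (closureEmb (K := ℚ) (v.adicCompletion ℚ)) A →+ ℤ_[2],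
            (∀ (t : A.subgroupH1 2 κ.kerSubgroup), t ∈ signedSelmerInfty A κ 1 →
              ∀ (φ : contOneCocycles (discreteTopRep κ.kerSubgroup (A.geomPrimaryTorsion 2)))
                (Q : localPoints A (v.adicCompletion ℚ)) (k : ℕ), oneCocycleClass _ φ = t →
              ∀ hQ : 2 ^ k • Q ∈ (⨆ n, signedLocalPoints κ (v.adicCompletion ℚ) A 1 n),
              (∀ τ : localSubgroupOfEmb κ.kerSubgroup (closureEmb (K := ℚ) (v.adicCompletion ℚ)),
                pointsMapOfEmb A (closureEmb (K := ℚ) (v.adicCompletion ℚ))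
                    ((φ.1 (resGalSubgroupOfEmb κ.kerSubgroup _ τ) : A.geomPrimaryTorsion 2) : A.geomPoints) =
                  (τ : Field.absoluteGaloisGroup (v.adicCompletion ℚ)) • Q - Q) →
              (PadicInt.toZModPow k
                  (z ⟨2 ^ k • Q, SignedKatoOffTwo.KummerPoint.iSup_signedLocalPoints_le_localTowerPointsOfEmb A 2 κ 1 v hQ⟩)).val •
                ((((2 : ℚ) ^ k)⁻¹ : ℚ) : AddCircle (1 : ℚ)) = 0) →
            ∀ n k : ℕ, ∃ c : A.torsionH1Over ((2 : ℤ) ^ k) (κ.layerSubgroup n),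
              (∀ w : HeightOneSpectrum (𝓞 ℚ), w ∉ ({u : HeightOneSpectrum (𝓞 ℚ) | ((2 : ℕ) : 𝓞 ℚ) ∈ u.asIdeal} ∪ A.badPlaces (𝓞 ℚ)) →
                ∀ 𝔓 ∈ w.primesAbove,
                  resLe (A.torsionGaloisModule ((2 : ℤ) ^ k)).toTopRep
                    (inf_le_left : κ.layerSubgroup n ⊓ 𝔓.inertia (absoluteGaloisGroup ℚ) ≤ κ.layerSubgroup n) 1 c = 0) ∧
              ∀ (Q : localPoints A (v.adicCompletion ℚ))
                (hQ : Q ∈ signedLocalPointsOfEmb κ (closureEmb (K := ℚ) (v.adicCompletion ℚ)) A 1 n),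
                CyclotomicLayer.layerPairingMod A (2 ^ k) (CyclotomicLayer.weilTowerPk A k) (CyclotomicLayer.weilTowerPk_pow A k)
                    (CyclotomicLayer.weilTowerPk_add_left A k) (CyclotomicLayer.weilTowerPk_add_right A k)
                    (CyclotomicLayer.weilTowerPk_smul A k) κ v n c ⟨Q, signedLocalPointsOfEmb_le κ _ A 1 n hQ⟩ =
                  PadicInt.toZModPow k ((2 : ℤ_[2]) ^ m₀ *
                    z ⟨Q, localLayerPointsOfEmb_le_localTowerPointsOfEmb κ _ A n (signedLocalPointsOfEmb_le κ _ A 1 n hQ)⟩)) :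
    ∀ (v : HeightOneSpectrum (𝓞 ℚ)), ((2 : ℕ) : 𝓞 ℚ) ∈ v.asIdeal →
      ∀ (A : WeierstrassCurve ℚ) [A.IsElliptic] [A.IsGloballyMinimal],
        A.HasCM → A.analyticRank = 0 → GoodSS A 2 → A.frobeniusTrace 2 = 0 →
        ∀ (κ : ZpExtension ℚ 2) (γ : Field.absoluteGaloisGroup ℚ),
          κ.IsCyclotomic → κ.IsTopGenerator γ →
        ∀ [ContinuousSMul ℤ_[2] (A.tateModule 2)] (I : Kato2004.IwasawaH1Data A 2 κ γ)
          (pair : ∀ n : ℕ, H1 (tateRep A 2) (κ.layerSubgroup n) →ₗ[ℤ_[2]]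
            (localLayerPointsOfEmb κ (closureEmb (K := ℚ) (v.adicCompletion ℚ)) A n →+ ℤ_[2])),
          -- (P3) in Literature names: `pair` IS the `T₂A`-adic local Tate pairing
          (∀ (n k : ℕ) (x : H1 (tateRep A 2) (κ.layerSubgroup n))
            (Q : localLayerPointsOfEmb κ (closureEmb (K := ℚ) (v.adicCompletion ℚ)) A n),
            PadicInt.toZModPow k (pair n x Q) = CyclotomicLayer.tatePairingPk A κ v n k x Q) →
        ∃ m : ℕ,
          (∀ z : localTowerPointsOfEmb κ (closureEmb (K := ℚ) (v.adicCompletion ℚ)) A →+ ℤ_[2],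
            (∀ (t : A.subgroupH1 2 κ.kerSubgroup), t ∈ signedSelmerInfty A κ 1 →
              ∀ (φ : contOneCocycles (discreteTopRep κ.kerSubgroup (A.geomPrimaryTorsion 2)))
                (Q : localPoints A (v.adicCompletion ℚ)) (k : ℕ), oneCocycleClass _ φ = t →
              ∀ hQ : 2 ^ k • Q ∈ (⨆ n, signedLocalPoints κ (v.adicCompletion ℚ) A 1 n),
              (∀ τ : localSubgroupOfEmb κ.kerSubgroup (closureEmb (K := ℚ) (v.adicCompletion ℚ)),
                pointsMapOfEmb A (closureEmb (K := ℚ) (v.adicCompletion ℚ))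
                    ((φ.1 (resGalSubgroupOfEmb κ.kerSubgroup _ τ) : A.geomPrimaryTorsion 2) : A.geomPoints) =
                  (τ : Field.absoluteGaloisGroup (v.adicCompletion ℚ)) • Q - Q) →
              (PadicInt.toZModPow k
                  (z ⟨2 ^ k • Q, SignedKatoOffTwo.KummerPoint.iSup_signedLocalPoints_le_localTowerPointsOfEmb A 2 κ 1 v hQ⟩)).val •
                ((((2 : ℚ) ^ k)⁻¹ : ℚ) : AddCircle (1 : ℚ)) = 0) →
            ∃ x : I.H, ∀ (n : ℕ) (Q : localPoints A (v.adicCompletion ℚ))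
              (hQ : Q ∈ signedLocalPointsOfEmb κ (closureEmb (K := ℚ) (v.adicCompletion ℚ)) A 1 n),
              (2 : ℤ_[2]) ^ m *
                  z ⟨Q, localLayerPointsOfEmb_le_localTowerPointsOfEmb κ _ A n (signedLocalPointsOfEmb_le κ _ A 1 n hQ)⟩ =
                pair n (I.proj n x) ⟨Q, signedLocalPointsOfEmb_le κ _ A 1 n hQ⟩) :=
  poitouTateDeepTwo_of_levelwise_of_badInertia hE fun A _ _ hcm κ _ _ ↦ by
    obtain ⟨e, he⟩ := exists_pow_smul_resLe_inertia_tate_eq_zero_of_hasCM A 2 hcm κ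
    refine ⟨e, fun n x w hw hw2 𝔓 h𝔓 ↦ he n x w (fun h2 ↦ hw2 ?_) hw 𝔓 h𝔓⟩
    -- `primesEquiv w = 2` ⇒ `2 ∈ w`
    exact (Rat.natCast_mem_asIdeal_iff w).mpr (h2 ▸ dvd_rfl)

end SignedLowerOffTwo.PTDeep

end Summit.BirchSwinnertonDyer.BirchSwinnertonDyer.Theorems

end
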